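import Summits.QuantumAdvantage.QuantumAdvantage.Theses.RingFrame
import Summits.QuantumAdvantage.QuantumAdvantage.Theorems.RingFrameBeta
import Summits.QuantumAdvantage.QuantumAdvantage.Theorems.RingFrameBridge
import Summits.QuantumAdvantage.AdviceFreeQNC0.CosetBound
import Summits.QuantumAdvantage.AdviceFreeQNC0.CrossTeamEmbedding
import Summits.QuantumAdvantage.AdviceFreeQNC0.WalkTransport
import HarnessLib

/-!
# Route RingFrame, crux α `RingToElim` (stmt-QuantumAdvantage-19119): the crux from `TRPlus` alone

Support theorem for the crux item, line `tensor` (planner qa-qnc0-p2): composing the three stubs of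
the line that are PROVED in the cell topic —

* `stub_coset`     : `crossTeamHard_of_trplus_of_elimHard` (`CosetBound.lean`),
* `stub_embed`     : `ringHardU_of_crossTeamHard` (`CrossTeamEmbedding.lean`),
* `stub_transport` : `ringHard_two_of_walkHard` (`WalkTransport.lean`) —

gives the route crux `RingToElim` (`ElimHard → RingHard 2`) from the single remaining, load-bearing
hypothesis of the line, `TRPlus` (tensor robustness of the augmented elimination codes
`C⁺_L(d) ⊗ C⁺_{L'}(d)` with additive slack, uniform in `d ≤ polylog`; ROUND-1 §9.27–9.28; OPEN,
not in print), stated as an explicit hypothesis with its body verbatim from the registered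
skeleton; and, with the route's closed items, the rung leaf (`adviceFreeQNC0_of_trplus`).

WHAT THIS IS NOT: not a proof of the crux — `TRPlus` is open. Companion:
`RingFrameRingToElimOfLDMA.lean` (line `product`, hypothesis `LDMAPolylog`).
-/

-- the sub-problem namespace `Summit.QuantumAdvantage.QuantumAdvantage` repeats the summit name by design (D-0017)
set_option linter.dupNamespace false

namespace Summit.QuantumAdvantage.QuantumAdvantage.Theorems

open Finset Summit.QuantumAdvantage.AdviceFreeQNC0
open Literature.Computability.MetaComplexity Literature.Computability.MetaComplexity.Smolensky

/-- **Crux α from `TRPlus`**: the body of line `tensor`'s load-bearing stub implies the route crux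
`RingToElim`. -/
theorem ringToElim_of_trplus
    (hT : ∀ ε : ℝ, 0 < ε → ∃ K : ℝ, 0 < K ∧ ∀ C : ℕ, ∃ L₀ : ℕ, ∀ L L' : ℕ, L₀ ≤ L → L₀ ≤ L' →
      ∀ d : ℕ, d ≤ (Nat.log 2 (min L L')) ^ C →
        ∀ X Y : (Fin L → Bool) → (Fin L' → Bool) → Bool, ColsIn d X → RowsIn d Y →
          ∃ W : (Fin L → Bool) → (Fin L' → Bool) → Bool, ColsIn d W ∧ RowsIn d W ∧
            (hw (xorM X W) : ℝ) ≤ K * hw (xorM X Y) + ε * (2 : ℝ) ^ (L + L')) :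
    Summit.QuantumAdvantage.QuantumAdvantage.Theses.RingFrame.RingToElim :=
  fun hE => ringHard_two_of_walkHard (ringHardU_of_crossTeamHard
    (crossTeamHard_of_trplus_of_elimHard hT hE))

/-- **The rung leaf from `TRPlus`**: with the route's closed items the whole route reduces to
`TRPlus`. -/
theorem adviceFreeQNC0_of_trplus
    (hT : ∀ ε : ℝ, 0 < ε → ∃ K : ℝ, 0 < K ∧ ∀ C : ℕ, ∃ L₀ : ℕ, ∀ L L' : ℕ, L₀ ≤ L → L₀ ≤ L' →
      ∀ d : ℕ, d ≤ (Nat.log 2 (min L L')) ^ C →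
        ∀ X Y : (Fin L → Bool) → (Fin L' → Bool) → Bool, ColsIn d X → RowsIn d Y →
          ∃ W : (Fin L → Bool) → (Fin L' → Bool) → Bool, ColsIn d W ∧ RowsIn d W ∧
            (hw (xorM X W) : ℝ) ≤ K * hw (xorM X Y) + ε * (2 : ℝ) ^ (L + L')) :
    Summit.QuantumAdvantage.AdviceFreeQNC0.AdviceFreeQNC0 :=
  Summit.QuantumAdvantage.QuantumAdvantage.Theses.RingFrame.closes (ringToElim_of_trplus hT)
    ringFrame_lowDegAvoidOfRobustHegedus ringFrame_robustHegedusFact ringFrame_elimSqrtOfSparse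
    ringFrame_elimHardOfSqrt bridgeRingToSep_proof

end Summit.QuantumAdvantage.QuantumAdvantage.Theorems
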